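import Summits.SmoothPoincare4.SmoothPoincare4.Theorems.CongruenceShadowsAgkCor6SufficiencySpineDefs
import Literature.Topology.FourManifolds.BoundaryCollarMatching
import Literature.Topology.FourManifolds.CollarCriterion

/-!
# Stub `stub_productLike` of line `lp-by-sphere-system-surgery` for crux `AgkCor6Sufficiency`
(item stmt-SmoothPoincare4-10894, routes CongruenceShadows / GroupTrisection; lead reshape r5, B1)

**Product-like normalisation of a boundary-extending diffeomorphism** (`ProductLikeNormalisation`,
`…SpineDefs.lean`; uniqueness of collars, Hirsch, *Differential Topology* (1976), Ch. 8 §1,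
Thm. 1.9 and its proof; Bröcker–Jänich (1982), (13.7)).  Let `H`, `H'` be compact smooth
`3`-manifolds with boundary, `b`, `b'` boundary data with open collar data `D`, `D'`
(`BoundaryData.OpenCollarData`, `CollarCriterion.lean`), `φ : ∂H ≅ ∂H'` and `Ψ : H ≅ H'` a
diffeomorphism inducing `φ` on the boundary (`Ψ ∘ b.incl = b'.incl ∘ φ`).  Then some
diffeomorphism `Ψ̃ : H ≅ H'` still induces `φ` and is product-like near the boundary:
`Ψ̃ (D x t) = D' (φ x) t` for `0 ≤ t ≤ ε`.

Proof.  Regard `H'` as a cobordism from `b'.carrier` to `∅` (incoming end `b'.incl`).  The two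
maps `e₁ (x', t) = Ψ (D (φ⁻¹ x') t)` and `e₂ (x', t) = D' x' t` are collars of the incoming end in
the explicit sense of the tree's ambient uniqueness of collars
(`Cobordism.exists_diffeomorph_comp_collar_eq_collar`, `CobordismEndCollarMatching.lean`: smooth on
a slab `∂ × [0, ε)`, starting at the inclusion, with a smooth inverse on an open set — here
`(φ ∘ proj_D ∘ Ψ⁻¹, height_D ∘ Ψ⁻¹)` on `Ψ (region_D)` and `(proj_{D'}, height_{D'})` on
`region_{D'}`).  That theorem (proved in the tree from the germ-extension theorem
`CollarGerm.exists_extension`, Bröcker–Jänich (13.7)) gives a self-diffeomorphism `Θ` of `H'`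
fixing `∂H'` pointwise with `Θ (e₁ (x', t)) = e₂ (x', t)` for `0 ≤ t < δ`; then `Ψ̃ = Θ ∘ Ψ` and
`ε = δ / 2` do.

References: Hirsch, *Differential Topology* (1976), Ch. 8 §1, Thm. 1.9 [HirschDT1976];
Bröcker–Jänich, *Introduction to Differential Topology* (1982), (13.7) [BrockerJanich1982];
Abrams–Gay–Kirby, Geom. Topol. 22 (2018), proof of Thm. 5 [AbramsGayKirby2018].
-/

noncomputable section

-- the prescribed namespace `Summit.<P>.<Sub>.…` duplicates `SmoothPoincare4` (P = Sub)
set_option linter.dupNamespace false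

namespace Summit.SmoothPoincare4.SmoothPoincare4.Cruxes.AgkCor6Sufficiency.LpBySphereSystemSurgery

open Set Function
open scoped _root_.Manifold _root_.ContDiff _root_.Topology
open Literature.Topology.FourManifolds

/-! ## The two collars of `∂H'` -/

section Collars

variable {H : Type} [TopologicalSpace H] [ChartedSpace (EuclideanHalfSpace 3) H]
  {H' : Type} [TopologicalSpace H'] [ChartedSpace (EuclideanHalfSpace 3) H']
  {b : BoundaryData (𝓡∂ 3) H (𝓡 2)} {b' : BoundaryData (𝓡∂ 3) H' (𝓡 2)}

/-- **The transported collar `e₁ (x', t) = Ψ (D (φ⁻¹ x') t)` is smooth on the slab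
`∂H' × [0, top_D)`** (composition of `φ⁻¹ × id`, the open collar map of `D` and `Ψ`). -/
theorem contMDiffOn_transportedCollar (D : b.OpenCollarData)
    (φ : b.carrier ≃ₘ⟮𝓡 2, 𝓡 2⟯ b'.carrier) (Ψ : H ≃ₘ⟮𝓡∂ 3, 𝓡∂ 3⟯ H') :
    ContMDiffOn ((𝓡 2).prod 𝓘(ℝ, ℝ)) (𝓡∂ 3) ∞
      (fun q : b'.carrier × ℝ => Ψ (D.toFun (φ.symm q.1) q.2)) (univ ×ˢ Ico 0 D.top) := by
  have hA : ContMDiff ((𝓡 2).prod 𝓘(ℝ, ℝ)) ((𝓡 2).prod 𝓘(ℝ, ℝ)) ∞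
      (fun q : b'.carrier × ℝ => ((φ.symm q.1, q.2) : b.carrier × ℝ)) :=
    (φ.symm.contMDiff.comp contMDiff_fst).prodMk contMDiff_snd
  have hB : ContMDiffOn ((𝓡 2).prod 𝓘(ℝ, ℝ)) (𝓡∂ 3) ∞
      (uncurry D.toFun ∘ fun q : b'.carrier × ℝ => ((φ.symm q.1, q.2) : b.carrier × ℝ))
      (univ ×ˢ Ico 0 D.top) :=
    D.contMDiffOn_toFun.comp hA.contMDiffOn fun q hq => ⟨mem_univ _, hq.2⟩
  exact Ψ.contMDiff.comp_contMDiffOn hB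

/-- **The inverse `(φ ∘ proj_D ∘ Ψ⁻¹, height_D ∘ Ψ⁻¹)` of the transported collar is smooth on
the open set `Ψ (region_D) = Ψ.symm ⁻¹' region_D`.** -/
theorem contMDiffOn_transportedCollarInv (D : b.OpenCollarData)
    (φ : b.carrier ≃ₘ⟮𝓡 2, 𝓡 2⟯ b'.carrier) (Ψ : H ≃ₘ⟮𝓡∂ 3, 𝓡∂ 3⟯ H') :
    ContMDiffOn (𝓡∂ 3) ((𝓡 2).prod 𝓘(ℝ, ℝ)) ∞
      (fun z : H' => ((φ (D.proj (Ψ.symm z)), D.height (Ψ.symm z)) : b'.carrier × ℝ))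
      (Ψ.symm ⁻¹' D.region) := by
  have h1 : ContMDiffOn (𝓡∂ 3) ((𝓡 2).prod 𝓘(ℝ, ℝ)) ∞
      (fun w : H => ((φ (D.proj w), D.height w) : b'.carrier × ℝ)) D.region :=
    (φ.contMDiff.comp_contMDiffOn D.contMDiffOn_proj).prodMk D.contMDiffOn_height
  exact h1.comp Ψ.symm.contMDiff.contMDiffOn fun z hz => hz

end Collars

/-! ## The proof -/

/-- **Registered stub `stub_productLike`** (B1 of line `lp-by-sphere-system-surgery`):
product-like normalisation of a boundary-extending diffeomorphism of compact `3`-manifolds with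
boundary — uniqueness of collars (Hirsch (1976), Ch. 8 §1, Thm. 1.9; Bröcker–Jänich (1982),
(13.7)), through the tree's ambient matching of two collars of an end of a cobordism
(`Cobordism.exists_diffeomorph_comp_collar_eq_collar`) applied to `Ψ ∘ D ∘ (φ⁻¹ × id)` and `D'`
in the cobordism `(H'; ∂H', ∅)`. [cite: BrockerJanich1982, (13.7)] -/
theorem stub_productLike : ProductLikeNormalisation := by
  intro H _ _ _ _ _ _ H' _ _ _ _ _ _ b b' D D' φ Ψ hΨ
  have hΨb : ∀ x, Ψ (b.incl x) = b'.incl (φ x) := fun x => congr_fun hΨ x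
  -- `H'` as a cobordism from `b'.carrier` to `∅`
  let X : Cobordism 2 b'.carrier PEmpty.{1} :=
    { W := H'
      inl := b'.incl
      inr := PEmpty.elim
      isSmoothEmbedding_inl := b'.isSmoothEmbedding
      isSmoothEmbedding_inr := isSmoothEmbedding_of_isEmpty _
      disjoint_range := by
        rw [Set.range_eq_empty PEmpty.elim]
        exact disjoint_empty _
      range_inl_union_range_inr := by
        rw [Set.range_eq_empty PEmpty.elim, union_empty, b'.range_incl] }
  -- the two collars of the incoming end, matched by the uniqueness of collars
  obtain ⟨Θ, -, hΘl, δ, hδ, -, -, hΘ⟩ := X.exists_diffeomorph_comp_collar_eq_collar D.top_pos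
    (fun q : b'.carrier × ℝ => Ψ (D.toFun (φ.symm q.1) q.2))
    (fun z : H' => ((φ (D.proj (Ψ.symm z)), D.height (Ψ.symm z)) : b'.carrier × ℝ))
    (Ψ.symm ⁻¹' D.region) (D.isOpen_region.preimage Ψ.symm.continuous)
    (fun m => by
      show Ψ (D.toFun (φ.symm m) 0) = b'.incl m
      rw [D.apply_zero, hΨb, φ.apply_symm_apply])
    (contMDiffOn_transportedCollar D φ Ψ)
    (fun q hq => by
      show Ψ.symm (Ψ (D.toFun (φ.symm q.1) q.2)) ∈ D.region
      rw [Ψ.symm_apply_apply]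
      exact D.mem_region _ _ hq.2)
    (fun z hz => ⟨⟨mem_univ _, D.height_mem _ hz⟩, by
      show Ψ (D.toFun (φ.symm (φ (D.proj (Ψ.symm z)))) (D.height (Ψ.symm z))) = z
      rw [φ.symm_apply_apply, D.apply_proj_height _ hz, Ψ.apply_symm_apply]⟩)
    (by
      rintro ⟨x', t⟩ ⟨-, ht⟩
      show ((φ (D.proj (Ψ.symm (Ψ (D.toFun (φ.symm x') t)))),
          D.height (Ψ.symm (Ψ (D.toFun (φ.symm x') t)))) : b'.carrier × ℝ) = (x', t)
      rw [Ψ.symm_apply_apply, D.proj_apply _ _ ht, D.height_apply _ _ ht, φ.apply_symm_apply])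
    (contMDiffOn_transportedCollarInv D φ Ψ)
    D'.top_pos (uncurry D'.toFun) (fun z : H' => ((D'.proj z, D'.height z) : b'.carrier × ℝ))
    D'.region D'.isOpen_region (fun m => D'.apply_zero m) D'.contMDiffOn_toFun
    (fun q hq => D'.mem_region _ _ hq.2)
    (fun z hz => ⟨⟨mem_univ _, D'.height_mem z hz⟩, D'.apply_proj_height z hz⟩)
    (by
      rintro ⟨x', t⟩ ⟨-, ht⟩
      exact Prod.ext (D'.proj_apply _ _ ht) (D'.height_apply _ _ ht))
    (D'.contMDiffOn_proj.prodMk D'.contMDiffOn_height)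
  -- `Ψ̃ = Θ ∘ Ψ`, `ε = δ / 2`
  refine ⟨Ψ.trans Θ, δ / 2, half_pos hδ, ?_, fun x t ht0 htε => ?_⟩
  · funext x
    simp only [comp_apply, Diffeomorph.coe_trans]
    rw [hΨb]
    exact hΘl (φ x)
  · rw [Diffeomorph.coe_trans, comp_apply]
    have h := hΘ (φ x) t ⟨ht0, by linarith⟩
    have hx : φ.symm (φ x) = x := φ.symm_apply_apply x
    simp only [hx] at h
    exact h

end Summit.SmoothPoincare4.SmoothPoincare4.Cruxes.AgkCor6Sufficiency.LpBySphereSystemSurgery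

end
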